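import Literature.NumberTheory.EllipticCurves.HeegnerPointsKolyvaginCebotarevPairProofs
import HarnessLib

/-!
# The pair Čebotarev step at a level given as `n = p ^ M` (and at the Sylvester level `2^κ · 2^κ`)

Topic `NumberTheory/EllipticCurves`; namespace `Literature.NumberTheory.EllipticCurves`. THEOREMS ONLY: **no definition and
no named fact** (D-0026). A leaf re-indexing of the tree's `exists_kolyvaginPrime_gt_of_galoisElement_pair`
(`HeegnerPointsKolyvaginCebotarevPairProofs`; McCallum 1991 §3 Prop. 3.1 / (3) for a PAIR of curves), whose level is the
literal `p ^ M`: consumers working at a level `n` that is only PROPOSITIONALLY `p ^ M` (the coupled descent of two `j = 0`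
curves runs at `n = 2^κ * 2^κ`, not syntactically `2 ^ (2κ)`) get the statement at `n` (`subst`), and the `2^κ * 2^κ`
instance by name, so that the Galois element of `JZeroTwoPowerTorsionKummerPair.exists_h1Eval_pair_two_pow` (level `n`)
feeds the `ρ` slot with no transport of classes.

References: [McCallumLMS1991] W. G. McCallum, *Kolyvagin's work on Shafarevich–Tate groups*, LMS LN 153 (1991), §3,
Prop. 3.1 (proof) and (3).
-/

noncomputable section

open scoped Classical
open WeierstrassCurve NumberField IsDedekindDomain Field
open Literature.NumberTheory.GaloisRepresentations

universe u

namespace Literature.NumberTheory.EllipticCurves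

variable {A B : WeierstrassCurve ℚ} {K : Type u} [Field K] [NumberField K]

/-- **The pair Čebotarev step at a level `n` GIVEN AS `n = p ^ M`** (the tree's
`exists_kolyvaginPrime_gt_of_galoisElement_pair`, re-indexed: `subst`). [cite: McCallumLMS1991, §3 Prop. 3.1 (proof), (3)] -/
theorem exists_kolyvaginPrime_gt_of_galoisElement_pair_of_eq (hC : Automorphic.chebotarev_artinRep)
    {NA NB : ℕ} [NeZero NA] [NeZero NB] [A.IsElliptic] [B.IsElliptic]
    (hK : IsImaginaryQuadratic K) {p : ℕ} (hp : p.Prime) {M n : ℕ} (hn : n = p ^ M)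
    {c : K ≃ₐ[ℚ] K} {c₀ : absoluteGaloisGroup ℚ} (hc₀ : IsComplexConjugation (Rat.castHom ℝ) c₀)
    (ht : IsLiftOfAut c (absGaloisTransport (K := ℚ) (L := K) c₀).toRingEquiv)
    (hinv : ∀ x, (absGaloisTransport (K := ℚ) (L := K) c₀).toRingEquiv
      ((absGaloisTransport (K := ℚ) (L := K) c₀).toRingEquiv x) = x)
    {ιA ιB : Type*} [Fintype ιA] [Fintype ιB]
    (csA : ιA → galH1Torsion (A.baseChange K) ((n : ℕ) : ℤ))
    (csB : ιB → galH1Torsion (B.baseChange K) ((n : ℕ) : ℤ))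
    {ρ : absoluteGaloisGroup K} (hρA : ρ ∈ torsionFixing (A.baseChange K) ((n : ℕ) : ℤ))
    (hρB : ρ ∈ torsionFixing (B.baseChange K) ((n : ℕ) : ℤ)) (b : ℕ) :
    ∃ ℓ : ℕ, b < ℓ ∧ ℓ.Prime ∧ ¬ ℓ ∣ NA ∧ ¬ ℓ ∣ NB ∧ ¬ ((ℓ : ℤ) ∣ NumberField.discr K) ∧
      ℓ ≠ p ∧ (Ideal.span {(ℓ : 𝓞 K)}).IsPrime ∧
      FrobEqFrobInfty A K n ℓ ∧ FrobEqFrobInfty B K n ℓ ∧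
      ∃ m : absoluteGaloisGroup K, m ∈ evalKer (A.baseChange K) ((n : ℕ) : ℤ) csA ∧
        m ∈ evalKer (B.baseChange K) ((n : ℕ) : ℤ) csB ∧
        (∀ x ∈ AddSubgroup.closure (Set.range csA),
          ∀ v : HeightOneSpectrum (𝓞 K), (ℓ : 𝓞 K) ∈ v.asIdeal →
            (x ∈ (A.baseChange K).torsionLocalKer (v.adicCompletion K) ((n : ℕ) : ℤ) ↔
              h1Eval (A.baseChange K) ((n : ℕ) : ℤ) x (ht.conjGalCMH (ρ * m) * (ρ * m)) = 0)) ∧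
        (∀ y ∈ AddSubgroup.closure (Set.range csB),
          ∀ v : HeightOneSpectrum (𝓞 K), (ℓ : 𝓞 K) ∈ v.asIdeal →
            (y ∈ (B.baseChange K).torsionLocalKer (v.adicCompletion K) ((n : ℕ) : ℤ) ↔
              h1Eval (B.baseChange K) ((n : ℕ) : ℤ) y (ht.conjGalCMH (ρ * m) * (ρ * m)) = 0)) := by
  subst hn
  exact exists_kolyvaginPrime_gt_of_galoisElement_pair hC hK hp hc₀ ht hinv csA csB hρA hρB b

/-- **The pair Čebotarev step at the level `2^κ · 2^κ` of the coupled `2`-descent** (`p = 2`, `M = 2κ`,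
`2^κ * 2^κ = 2 ^ (2κ)` by `two_mul`/`pow_add`). [cite: McCallumLMS1991, §3 Prop. 3.1 (proof), (3)] -/
theorem exists_kolyvaginPrime_gt_of_galoisElement_pair_two_pow_mul (hC : Automorphic.chebotarev_artinRep) {NA NB : ℕ} [NeZero NA] [NeZero NB] [A.IsElliptic] [B.IsElliptic]
    (hK : IsImaginaryQuadratic K) (κ : ℕ)
    {c : K ≃ₐ[ℚ] K} {c₀ : absoluteGaloisGroup ℚ} (hc₀ : IsComplexConjugation (Rat.castHom ℝ) c₀)
    (ht : IsLiftOfAut c (absGaloisTransport (K := ℚ) (L := K) c₀).toRingEquiv)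
    (hinv : ∀ x, (absGaloisTransport (K := ℚ) (L := K) c₀).toRingEquiv
      ((absGaloisTransport (K := ℚ) (L := K) c₀).toRingEquiv x) = x)
    {ιA ιB : Type*} [Fintype ιA] [Fintype ιB]
    (csA : ιA → galH1Torsion (A.baseChange K) ((2 ^ κ * 2 ^ κ : ℕ) : ℤ))
    (csB : ιB → galH1Torsion (B.baseChange K) ((2 ^ κ * 2 ^ κ : ℕ) : ℤ))
    {ρ : absoluteGaloisGroup K} (hρA : ρ ∈ torsionFixing (A.baseChange K) ((2 ^ κ * 2 ^ κ : ℕ) : ℤ))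
    (hρB : ρ ∈ torsionFixing (B.baseChange K) ((2 ^ κ * 2 ^ κ : ℕ) : ℤ)) (b : ℕ) :
    ∃ ℓ : ℕ, b < ℓ ∧ ℓ.Prime ∧ ¬ ℓ ∣ NA ∧ ¬ ℓ ∣ NB ∧ ¬ ((ℓ : ℤ) ∣ NumberField.discr K) ∧
      ℓ ≠ 2 ∧ (Ideal.span {(ℓ : 𝓞 K)}).IsPrime ∧
      FrobEqFrobInfty A K (2 ^ κ * 2 ^ κ) ℓ ∧ FrobEqFrobInfty B K (2 ^ κ * 2 ^ κ) ℓ ∧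
      ∃ m : absoluteGaloisGroup K, m ∈ evalKer (A.baseChange K) ((2 ^ κ * 2 ^ κ : ℕ) : ℤ) csA ∧
        m ∈ evalKer (B.baseChange K) ((2 ^ κ * 2 ^ κ : ℕ) : ℤ) csB ∧
        (∀ x ∈ AddSubgroup.closure (Set.range csA),
          ∀ v : HeightOneSpectrum (𝓞 K), (ℓ : 𝓞 K) ∈ v.asIdeal →
            (x ∈ (A.baseChange K).torsionLocalKer (v.adicCompletion K) ((2 ^ κ * 2 ^ κ : ℕ) : ℤ) ↔
              h1Eval (A.baseChange K) ((2 ^ κ * 2 ^ κ : ℕ) : ℤ) x (ht.conjGalCMH (ρ * m) * (ρ * m)) = 0)) ∧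
        (∀ y ∈ AddSubgroup.closure (Set.range csB),
          ∀ v : HeightOneSpectrum (𝓞 K), (ℓ : 𝓞 K) ∈ v.asIdeal →
            (y ∈ (B.baseChange K).torsionLocalKer (v.adicCompletion K) ((2 ^ κ * 2 ^ κ : ℕ) : ℤ) ↔
              h1Eval (B.baseChange K) ((2 ^ κ * 2 ^ κ : ℕ) : ℤ) y (ht.conjGalCMH (ρ * m) * (ρ * m)) = 0)) :=
  exists_kolyvaginPrime_gt_of_galoisElement_pair_of_eq hC hK Nat.prime_two (M := 2 * κ) (by rw [two_mul, pow_add])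
    hc₀ ht hinv csA csB hρA hρB b

end Literature.NumberTheory.EllipticCurves

end
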